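import Mathlib
import Summits.Ventures.PercRepro2.PointSplitCondCov

/-!
# (PS1) = the `v`-class slack + BHK + the product of the point covariances
(blind cell PercRepro2, night-3 g24, 2026-08-29; `proofs/NIGHT3-CERT.md` §33.6)

At a common avoided set `X` (`Q = {s ↮ X}`), with `π = E[1_{vH}; Q]`, `π_Q = E[1; Q]`,
`x = E[FG·1_{vH}; Q]`, `a = E[F·1_{vH}; Q]`, `c = E[G·1_{vH}; Q]`, `y = E[FG; Q]`, `b = E[F; Q]`,
`d = E[G; Q]`, the second point-split form is `M(1_{vH}, 1) = x·π_Q + y·π − a·d − b·c` and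

  `π·π_Q·M(1_{vH}, 1) = π_Q²·(πx − ac) + π²·(π_Q y − bd) + (π_Q a − πb)·(π_Q c − πd)`

(`mul_mixedForm_one_eq_classSlack_add`).  The three summands are: `π_Q²` times the **`v`-class
slack** `S_{1_{vH}}(F, G) = πx − ac` (the BHK form at the weight `1_{v ∈ C_s}`; NOT signed), `π²`
times the **BHK form** `S_1(F, G) = π_Q y − bd ≥ 0` (`bhkForm_one_nonneg`), and the product of the
two **point covariances** `S_1(F, 1_{v∈·}) = π_Q a − πb ≥ 0` and `S_1(G, 1_{v∈·}) ≥ 0` (BHK with the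
monotone functional `1_{v ∈ ·}`).  In conditional language (`X = ∅`, `A = {v ∈ C_s}`):
`(PS1) = π·[Cov_A(F, G) + Cov(F, G)] + Cov(F, 1_A)·Cov(G, 1_A)/π`.

* **`PointSplitS5`** — the CANDIDATE `π_Q²·S_{1_{vH}}(F,G) + π²·S_1(F,G) ≥ 0`, i.e.
  `Cov_A(F, G) + Cov(F, G) ≥ 0`: the covariance under the conditioning `{s ↔ v}` is at least minus
  the unconditioned covariance (NOT claimed proved; exact census night-3 g24: 0 failures / 750).
  It is STRONGER than (PS1): `(PS1) ≥ Cov(F, 1_A)·Cov(G, 1_A)/P(A)`.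
* **`mixedForm_one_nonneg_of_pointSplitS5`**: (S5) ⟹ (PS1) = `M(1_{vH}, 1) ≥ 0` at every `X = Y`,
  the degenerate classes included.

Own work; standard axioms.
-/

namespace Summit.Ventures.PercRepro2

open UnionCluster

namespace CovForm

namespace PointSplit

variable {V : Type*} {E : Type*} [Fintype E] [DecidableEq E]
  {R : Type*} [Field R] [LinearOrder R] [IsStrictOrderedRing R]

/-- The **`v`-class slack plus BHK** form
`π_Q²·(πx − ac) + π²·(π_Q y − bd)` (notation of the module docstring). -/
noncomputable def s5Form (p : E → R) (ends : E → Sym2 V) (s : V) (X : Finset V)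
    (F G : Set V → R) (v : V) : R :=
  (wExpect p ends s X (fun _ => 1) (fun _ => 1)) ^ 2 *
      (wExpect p ends s X (fun _ => 1) ((connEvent ends s v).indicator 1) *
          wExpect p ends s X (fun W => F W * G W) ((connEvent ends s v).indicator 1) -
        wExpect p ends s X F ((connEvent ends s v).indicator 1) *
          wExpect p ends s X G ((connEvent ends s v).indicator 1)) +
    (wExpect p ends s X (fun _ => 1) ((connEvent ends s v).indicator 1)) ^ 2 *
      (wExpect p ends s X (fun _ => 1) (fun _ => 1) *
          wExpect p ends s X (fun W => F W * G W) (fun _ => 1) -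
        wExpect p ends s X F (fun _ => 1) * wExpect p ends s X G (fun _ => 1))

omit [LinearOrder R] [IsStrictOrderedRing R] in
/-- `E[F · 1_{v ∈ ·}; X] = E[F·1_{vH}; X]`. -/
lemma wExpect_mul_indicator_mem_eq (p : E → R) (ends : E → Sym2 V) (s v : V) (X : Finset V)
    (F : Set V → R) :
    wExpect p ends s X (fun W => F W * {W : Set V | v ∈ W}.indicator 1 W) (fun _ => 1) =
      wExpect p ends s X F ((connEvent ends s v).indicator 1) := by
  unfold wExpect
  refine congrArg _ (funext fun ω => ?_)
  by_cases h : ω ∈ connEvent ends s v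
  · have h' : cluster ends ω s ∈ {W : Set V | v ∈ W} := h
    simp [Set.indicator_of_mem h, Set.indicator_of_mem h']
  · have h' : cluster ends ω s ∉ {W : Set V | v ∈ W} := h
    simp [Set.indicator_of_notMem h, Set.indicator_of_notMem h']

omit [LinearOrder R] [IsStrictOrderedRing R] in
/-- `E[1_{v ∈ ·}; X] = E[1_{vH}; X]`. -/
lemma wExpect_indicator_mem_eq (p : E → R) (ends : E → Sym2 V) (s v : V) (X : Finset V) :
    wExpect p ends s X (fun W => {W : Set V | v ∈ W}.indicator 1 W) (fun _ => 1) =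
      wExpect p ends s X (fun _ => 1) ((connEvent ends s v).indicator 1) := by
  unfold wExpect
  refine congrArg _ (funext fun ω => ?_)
  by_cases h : ω ∈ connEvent ends s v
  · have h' : cluster ends ω s ∈ {W : Set V | v ∈ W} := h
    simp [Set.indicator_of_mem h, Set.indicator_of_mem h']
  · have h' : cluster ends ω s ∉ {W : Set V | v ∈ W} := h
    simp [Set.indicator_of_notMem h, Set.indicator_of_notMem h']

omit [LinearOrder R] [IsStrictOrderedRing R] in
/-- The point covariance `S_1(F, 1_{v ∈ ·}) = π_Q a − πb` as a BHK form. -/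
lemma bhkForm_one_point_eq [DecidableEq V] (p : E → R) (ends : E → Sym2 V) (s v : V)
    (X : Finset V) (F : Set V → R) :
    bhkFormW p ends s X X F (fun W => {W : Set V | v ∈ W}.indicator 1 W) (fun _ => 1) =
      wExpect p ends s X (fun _ => 1) (fun _ => 1) *
          wExpect p ends s X F ((connEvent ends s v).indicator 1) -
        wExpect p ends s X F (fun _ => 1) *
          wExpect p ends s X (fun _ => 1) ((connEvent ends s v).indicator 1) := by
  unfold bhkFormW
  rw [Finset.inter_self, Finset.union_self]
  have e1 : wExpect p ends s X (fun W => F W * (fun W => {W : Set V | v ∈ W}.indicator 1 W) W)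
      (fun _ => 1) = wExpect p ends s X F ((connEvent ends s v).indicator 1) :=
    wExpect_mul_indicator_mem_eq p ends s v X F
  rw [e1, wExpect_indicator_mem_eq]
  ring

omit [LinearOrder R] [IsStrictOrderedRing R] in
/-- **The decomposition (PS1) = `v`-class slack + BHK + point covariances**:
`π·π_Q·M(1_{vH}, 1) = s5Form + S_1(F, 1_{v∈·})·S_1(G, 1_{v∈·})`. -/
theorem mul_mixedForm_one_eq_classSlack_add [DecidableEq V] (p : E → R) (ends : E → Sym2 V)
    (s v : V) (X : Finset V) (F G : Set V → R) :
    wExpect p ends s X (fun _ => 1) ((connEvent ends s v).indicator 1) *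
        wExpect p ends s X (fun _ => 1) (fun _ => 1) *
        mixedFormW p ends s X X F G ((connEvent ends s v).indicator 1) (fun _ => 1) =
      s5Form p ends s X F G v +
        bhkFormW p ends s X X F (fun W => {W : Set V | v ∈ W}.indicator 1 W) (fun _ => 1) *
          bhkFormW p ends s X X G (fun W => {W : Set V | v ∈ W}.indicator 1 W) (fun _ => 1) := by
  rw [bhkForm_one_point_eq, bhkForm_one_point_eq]
  unfold mixedFormW s5Form
  rw [Finset.inter_self, Finset.union_self]
  ring

/-- **(S5), a CANDIDATE (NOT claimed proved)**: `s5Form ≥ 0` for every product law, avoided set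
`X`, split point `v` and nonnegative monotone `F, G` — i.e. `Cov_A(F,G) + Cov(F,G) ≥ 0` for
`A = {v ∈ C_s}` on `{s ↮ X}`.  Census (night-3 g24, exact, `X = ∅`): 0 failures / 750. -/
def PointSplitS5 [DecidableEq V] (ends : E → Sym2 V) (s : V) : Prop :=
  ∀ (p : E → R), IsProbVec p → ∀ (X : Finset V) (v : V) (F G : Set V → R),
    Monotone F → Monotone G → (∀ S, 0 ≤ F S) → (∀ S, 0 ≤ G S) → 0 ≤ s5Form p ends s X F G v

/-- **(S5) ⟹ (PS1) at `X = Y`**, the degenerate classes included. -/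
theorem mixedForm_one_nonneg_of_pointSplitS5 [Fintype V] [DecidableEq V] (ends : E → Sym2 V)
    (s : V) (hS5 : PointSplitS5 (R := R) ends s) (p : E → R) (hp : IsProbVec p) (X : Finset V)
    (v : V) {F G : Set V → R} (hF : Monotone F) (hG : Monotone G) (hF0 : ∀ S, 0 ≤ F S)
    (hG0 : ∀ S, 0 ≤ G S) :
    0 ≤ mixedFormW p ends s X X F G ((connEvent ends s v).indicator 1) (fun _ => 1) := by
  have hw₁ : ∀ ω, 0 ≤ (connEvent ends s v).indicator (1 : Config E → R) ω :=
    fun ω => Set.indicator_apply_nonneg fun _ => zero_le_one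
  have hπ0 : 0 ≤ wExpect p ends s X (fun _ => 1) ((connEvent ends s v).indicator 1) := by
    unfold wExpect
    exact expect_nonneg hp fun ω => mul_nonneg (mul_nonneg zero_le_one (hw₁ ω))
      (Set.indicator_apply_nonneg fun _ => zero_le_one)
  have hπQ0 : 0 ≤ wExpect p ends s X (fun _ => 1) (fun _ => 1) := by
    unfold wExpect
    exact expect_nonneg hp fun ω => mul_nonneg (mul_nonneg zero_le_one zero_le_one)
      (Set.indicator_apply_nonneg fun _ => zero_le_one)
  have hmono : Monotone (fun W : Set V => {W : Set V | v ∈ W}.indicator (1 : Set V → R) W) :=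
    monotone_indicator_one_of_isUpperSet (fun W W' h hW => h hW)
  have hnn : ∀ S, 0 ≤ (fun W : Set V => {W : Set V | v ∈ W}.indicator (1 : Set V → R) W) S :=
    fun S => Set.indicator_apply_nonneg fun _ => zero_le_one
  have hPF := bhkForm_one_nonneg p hp ends s X X hF hmono hF0 hnn
  have hPG := bhkForm_one_nonneg p hp ends s X X hG hmono hG0 hnn
  have key := mul_mixedForm_one_eq_classSlack_add p ends s v X F G
  rcases hπ0.lt_or_eq with hπ | hπ
  · have hπQ : 0 < wExpect p ends s X (fun _ => 1) (fun _ => 1) := by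
      rw [wExpect_one_split p ends s v X (fun _ => 1)]
      have : 0 ≤ wExpect p ends s X (fun _ => 1) (((connEvent ends s v)ᶜ).indicator 1) := by
        unfold wExpect
        exact expect_nonneg hp fun ω => mul_nonneg (mul_nonneg zero_le_one
          (Set.indicator_apply_nonneg fun _ => zero_le_one))
          (Set.indicator_apply_nonneg fun _ => zero_le_one)
      linarith
    have hpos : 0 < wExpect p ends s X (fun _ => 1) ((connEvent ends s v).indicator 1) *
        wExpect p ends s X (fun _ => 1) (fun _ => 1) := mul_pos hπ hπQ
    have h0 : 0 ≤ wExpect p ends s X (fun _ => 1) ((connEvent ends s v).indicator 1) *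
        wExpect p ends s X (fun _ => 1) (fun _ => 1) *
        mixedFormW p ends s X X F G ((connEvent ends s v).indicator 1) (fun _ => 1) := by
      rw [key]
      exact add_nonneg (hS5 p hp X v F G hF hG hF0 hG0) (mul_nonneg hPF hPG)
    exact (mul_nonneg_iff_of_pos_left hpos).1 h0
  · -- `π = 0`: the `v`-class is void and `M = 0`
    have hz := hπ.symm
    have hx := wExpect_eq_zero_of_mass_zero hp ends s X (fun W => F W * G W) hw₁ hz
    have ha := wExpect_eq_zero_of_mass_zero hp ends s X F hw₁ hz
    have hc := wExpect_eq_zero_of_mass_zero hp ends s X G hw₁ hz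
    rw [mixedForm_one_diag_eq, hx, ha, hc, hz]
    ring_nf
    exact le_refl 0

end PointSplit

end CovForm

end Summit.Ventures.PercRepro2
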